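import Summits.HubbardSuperconductivity.HubbardSuperconductivity.Theorems.NodalWardXYVisonPairCost

/-!
# Line `Sketch` (log-determinant transfer) for the crux `NodalWardXY.VisonPairCost`
# (item stmt-HubbardSuperconductivity-1266) — FINAL skeleton (sorry-free)

All 18 registered stubs of the line have landed as `Theorems/NodalWardXYVisonPairCost*.lean` (wave 1: p88997 p88561 p90589
p89048 p88024 p88033; wave 2: p92749 p92026 p91987 p92600 p92866 p92902; wave 3: p93845 p93565 p94177; lead: Defs p86620,
IRDefs p91219, SymbolDefs p93172, SymbolAssembly p94278; Literature toolkits p90049 p92185 p92508 p92597 p92604) and the closing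
theorem `Theorems/NodalWardXYVisonPairCost.lean` (p94748, ACCEPTED):
`Summit.HubbardSuperconductivity.HubbardSuperconductivity.Theorems.VisonPairCost.visonPairCost_proof : VisonPairCost`,
axioms `propext`, `Classical.choice`, `Quot.sound`.
-/

noncomputable section

-- tree namespace Summit.HubbardSuperconductivity.HubbardSuperconductivity (D-0017)
set_option linter.dupNamespace false

namespace Summit.HubbardSuperconductivity.HubbardSuperconductivity.Cruxes.VisonPairCost.Sketch

open Summit.HubbardSuperconductivity.HubbardSuperconductivity.Theses.NodalWardXY

/-- The line closes the crux (no stubs left). -/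
theorem VisonPairCost_of : VisonPairCost :=
  Summit.HubbardSuperconductivity.HubbardSuperconductivity.Theorems.VisonPairCost.visonPairCost_proof

end Summit.HubbardSuperconductivity.HubbardSuperconductivity.Cruxes.VisonPairCost.Sketch

end
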